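import Summits.QuantumFields.YangMills.Theses.ContractibleFibre
import Summits.QuantumFields.YangMills.Theorems.ContractibleFibreFibreAnchorTraceFormulaClustering
import Summits.QuantumFields.YangMills.Theorems.ContractibleFibreFibreAnchorTracePackaging
import Summits.QuantumFields.YangMills.Theorems.ContractibleFibreFibreAnchorVdrPlanar

/-!
# Line `trace-vdr` — crux `FibreAnchor` (stmt-QuantumFields-16243), route `ContractibleFibre`

Strategist line (crux-strategist `cstrat-stmt-QuantumFields-16243-b1`, 2026-08-17), registered as an
ALTERNATIVE to the birth skeleton `Lines/birth.lean` (small-field-conditioned anchor + large-field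
stability). Card: `Lines/trace_vdr.md`.

Crux (route decl `Summit.QuantumFields.YangMills.Theses.ContractibleFibre.FibreAnchor`, rank 3, XL): for
every compact simple `G`, faithful unitary `r` and EVERY fibre width `M` there are `β₀(M)` and a
β-UNIFORM rate `m₀(M) > 0` such that for `β ≥ β₀(M)`, every slab width `w`, some `C`, `L_min`: on every
free tube `(ℤ/L)²×{0..M}²` with `L ≥ L_min` all bounded measurable time-slab observables cluster in time,
`|E[F₁·F₂∘σ_n] − E[F₁]E[F₂∘σ_n]| ≤ C e^{−m₀ n}` for `2n < L`, with `C` uniform in `L` and in the observables.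

## The cut: PARTITION FUNCTIONS FIRST (vacuum dominance with a rate), THEN THE TRACE FORMULA

The typed crux asks for TWO things at once: a β-uniform RATE, and constants uniform in `L` over ALL
bounded slab observables of arbitrary spatial extent. Under time-reflection positivity the second is not
analysis but spectral bookkeeping: with the slice transfer operator `T_L ≥ 0` (Lüscher 1977 /
Osterwalder–Seiler 1978) the torus expectation is a TRACE, `E[F₁·F₂∘σ_n] = Tr(𝔽₁ T^{n−w} 𝔽₂ T^{L−n−w})/Tr T^L`,
and uniform clustering at rate `m₀/2` follows from exactly two spectral facts about the family `T_L`: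
a gap `λ₁(L)/λ₀(L) ≤ e^{−m₀}` and vacuum dominance `Tr T_L^{j}/λ₀(L)^{j} ≤ exp(C·L·e^{−m₀ j})`. BOTH are
statements about PARTITION FUNCTIONS of ASYMMETRIC tubes `(ℤ/j)×(ℤ/L)×Fin(M+1)²` only
(`Tr T_L^j = Z(L, j)`), and together they are ONE two-sided inequality:

  `lam^j ≤ Z(L, j)` for all `j ≥ 1`, and `Z(L, j) ≤ lam^j · exp(C·L·e^{−m₀ j})` for `1 ≤ j ≤ L`   (VDR)

for some `lam = lam(L) > 0` (forced to be `λ₀(L)` by the lower bounds). VDR is precisely the output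
format of a convergent polymer expansion of `log Z` on a torus — bulk term `L·j·p(β)` plus winding
corrections, `L` positions × `e^{−m₀ j}` for polymers winding the time circle (Kotecký–Preiss 1986;
Borgs–Imbrie 1989) — and in the exactly solvable planar member `M = 0` it is Migdal's character sum
`Z = Σ_ρ ĉ_ρ(β)^{L j}`, where the torelon floor `σ₂(β)·L_min ≥ m₀` of the route appears as the
condition making `Σ_{ρ≠1} ĉ_ρ^{Lj} ≤ C L e^{−m₀ j}`.

* `stub_vacuumDominanceRate` (S1 — THE ANCHOR IN PARTITION-FUNCTION FORM; hardest, open, L/XL):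
  ∀ G r M ∃ β₀ m₀>0 ∀ β ≥ β₀ ∃ C L_min ∀ L ≥ L_min ∃ lam>0: VDR as displayed, `Z(L, j)` = the
  inline Wilson partition function of the free tube with time period `j+1` and space period `L`
  (same `sh / ins / pl / act` vocabulary as the crux, first factor `ZMod (j+1)`).
* `stub_traceFormulaClustering` (S2a — ABSTRACT, pure operator theory, M/L): for ANY probability space
  `(X, μ)` and bounded, jointly measurable, symmetric, pointwise non-negative, positive-semidefinite
  kernel `K`, if the cyclic partition functions `Z_j = ∫ ∏_{t : ZMod (j+1)} K(V t, V (t+1)) dμ^{j+1}`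
  satisfy VDR with entropy constant `E ≥ 0` and rate `m₀` up to the period `N`, and
  `N ≥ (4/m₀) log(2+E) + 4(w+1)`, then every pair of `[c, c+w]`-slab observables of the cyclic chain of
  period `N`, bounded by 1, clusters at rate `m₀/2` with the ABSOLUTE constant `64·e^{m₀(w+1)}`.
  (Quantitative, Jentzsch-free form of the tree's `Literature.Analysis.OperatorTheory.exists_cyclic_clustering_zmod`,
  whose constants depend on the kernel: here they depend on nothing.) Proof: `T = T_K ≥ 0` is
  Hilbert–Schmidt, `Z_j = Tr T^{j+1}` (`j ≥ 1`); the lower bounds give `lam ≤ λ₀ = ‖T‖`; the upper bound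
  at `j+1 = N` gives `Tr T^N < 2λ₀^N` (simple vacuum) and `λ₁ ≤ λ₀ e^{−m₀/2}`; insertion operators are
  dominated by `T^w` (`K ≥ 0`, `|F| ≤ 1`); expand `T^a = λ₀^a Π₀ + R^a` in the trace formula and bound
  `Tr R^a ≤ λ₀^a (exp(E e^{−m₀ a}) − 1)` for `a ≥ N/2 − w` (Glimm–Jaffe 1987 §6.1; OS 1978 §2).
* `stub_tracePackaging` (S2b — TIME-SLICING OF THE FREE TUBE, M/L): (S2a) → for every `G, r, M, β, m₀, C,
  L_min`: VDR on `L ≥ L_min` ⇒ for every `w` constants `C', L_min'` with the crux's `Tube M β (m₀/2) C' w L_min'`.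
  Content: the marginal law of the spatial slices `V_t ∈ X_L = ((ℤ/L)×Fin(M+1)²)×Fin 3 → G` is the cyclic
  chain of the slice kernel `K_L(x,y) = e^{½S_sp(x)} [∫ ∏_s dg_s ∏_ℓ e^{β·ins_ℓ·Re tr r(g_s y_ℓ g_{s+μ}⁻¹ x_ℓ⁻¹)}] e^{½S_sp(y)}`
  (continuous, bounded, `> 0`, symmetric; positive-semidefinite because `e^{β Re tr r(·)}` is a
  positive-definite class function — non-negative character coefficients — averaged over the gauge
  group: Lüscher 1977, OS 1978 Thm. 2.x); `Z(L, j)` of S1 IS the chain's `Z_j`; given the slices the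
  time-like layers are conditionally INDEPENDENT, so `E[F₁·F₂∘σ_n] = E[F̃₁·F̃₂∘σ_n]` with
  `F̃ = E[F | slices]` a `[c, c+w+1]`-slab chain observable bounded by 1 (no gauge fixing, no gauge
  invariance of `F` needed; `n > w`, else the bound is trivial); apply S2a with `E = C·L`, `N = L`,
  `w+1`, for `L ≥ L_min' := max(L_min, L₁(C, m₀, w))`.
* `FibreAnchor_of : FibreAnchor` — composition BY NAME: from S1 at `(G, r, M)` take `β₀, m₀`; answer the
  crux with rate `m₀/2`; for `β ≥ β₀` feed S1's `C, L_min, VDR` and S2a to S2b.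

Neither stub is the crux or the summit in disguise: S1 speaks of partition functions of a DIFFERENT
(two-period) family and contains no observable; S2a is group-free operator theory; S2b is a conditional
whose antecedents are S2a and VDR. First lemmas of the technique (elaborated, strategist `Sketch.lean`,
quoted in the card): the lattice DIAMAGNETIC bound (Brydges–Fröhlich–Seiler) — β- and background-uniform
decay of the KK propagators that makes S1's polymer activities decay at a β-uniform rate — and the
finite-dimensional shadow of S2a (trace domination ⇒ simple vacuum + gap).

## Disproof used

None exists for this crux (no `Disproof.lean`, no `Theorems/FibreAnchor/Negative/`, no crux ideas; one
registered line `Lines/birth.lean`). Negatives index of the summit (`ledger negatives`): nothing on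
free-tube / slab clustering or on partition-function ratios; no stub is an instance of a refuted
statement. Typing checklist 4c(ii): every `∫` is against a finite product of Haar probability measures
of a bounded continuous (S1) / bounded measurable (S2a: `Measurable`, `|F| ≤ 1` binders present) integrand.

`lean check`: rc 0; sorries = 3 = stubs; `FibreAnchor_of` audited as proof-of-item of the route decl.
Namespace `Summit.QuantumFields.YangMills.Cruxes.FibreAnchor.TraceVDR`.

## Lead reshape r1 (prover-line-stmt-QuantumFields-16243-0, 2026-08-17)

Two signature repairs, composition re-checked (same three stubs, same cut):
* the VDR clauses of S1 / S2a / S2b quantify over time periods `j + 1 ≥ 2` only (`1 ≤ j →` added to both the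
  lower and the upper bound). The period-1 member `Z(L, 0)` is the trace of the slice transfer operator only in
  Mercer's sense (`∫ K(x,x) dμ`, not `Σ λᵢ` without a Mercer theorem, absent from Mathlib) and S2a never uses it
  (all arcs it evaluates have ≥ 2 bonds under its threshold `N ≥ 4(w+1)`); dropping it removes a spurious
  obligation from S1 and a spurious (unused) hypothesis from S2a.
* S2b carries `0 ≤ β`: the slice kernel is of positive type because `exp(β·Re tr r(ab⁻¹))` is a positive-definite
  kernel on `G`, which needs `β ≥ 0` (tree: `posType_wilsonSliceKernel` is stated for `0 ≤ β`); `FibreAnchor_of`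
  absorbs it by answering the crux with threshold `max β₀ 0`.

## Lead reshape r2 (2026-08-17, after wave 1)

S2a `stub_traceFormulaClustering` LANDED verbatim (p162688, `Theorems/ContractibleFibreFibreAnchorTraceFormulaClustering.lean`,
with Literature helpers p161098 p161108 p161116 p161125 p162091); the skeleton now imports it. S2b is re-cut WITHOUT the S2a
antecedent (two registered stubs remain: S1, S2b); its proof (wave-1 worker, rc 0 against Literature helpers
`FreeTubeSliceAssembly` p161167, `FreeTubeTransferKernel` p161836, `FreeTubeSlabCovariance` p162226, `CyclicChainCondExp` p160680)
applies the old conditional form to the landed S2a.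

## Lead reshape r3 (2026-08-17, after S2b landed p162988)

S2b LANDED (`Theorems/ContractibleFibreFibreAnchorTracePackaging.lean`, p162988); the skeleton imports it. The former S1
is split BY FIBRE WIDTH into two registered stubs with the same VDR clause: `stub_vdrPlanar` (M = 0, any rate `m₀ > 0`,
any `β ≥ 0`: the exactly solvable member, provable now with the tree's Jentzsch machinery — no Peter–Weyl) and
`stub_vdrThick` (1 ≤ M: the open XL core, verbatim the old S1 restricted to thick fibres). `FibreAnchor_of` cases on
`M`: planar ⇒ threshold `0`, rate `1/2`; thick ⇒ threshold `max β₀ 0`, rate `m₀/2`. Sorries = 2 = stubs.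

## Lead integration r4 (2026-08-17, after wave 2)

`stub_vdrPlanar` LANDED (p165809); the skeleton imports it. ONE registered stub remains: `stub_vdrThick` (VDR for fibre widths
`M ≥ 1` — the open XL core: a β-uniform weak-coupling expansion of `log Z(L, j)` for the free tube, not in print). The crux
`FibreAnchor` is therefore CLOSED MODULO `stub_vdrThick`: packaging (S2a p162688, S2b p162988) and the planar member (p165809) are
kernel-checked; the `M = 0` branch of `FibreAnchor_of` is sorry-free (it also yields the route's support item `PlanarAnchor`).
-/

set_option autoImplicit false

noncomputable section

namespace Summit.QuantumFields.YangMills.Cruxes.FibreAnchor.TraceVDR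

open scoped BigOperators
open MeasureTheory
open Summit.QuantumFields.YangMills.Theses.ContractibleFibre

/-! Stub S1₀ `stub_vdrPlanar` (vacuum dominance with a rate for the planar free tube, M = 0 — the exactly solvable member,
any rate `m₀ > 0`, any `β ≥ 0`) LANDED: `Summits/QuantumFields/YangMills/Theorems/ContractibleFibreFibreAnchorVdrPlanar.lean`
(p165809, wave 2; Literature helpers p165097 CentralFunctionTransferKernel, p165121 KernelPowerTraceGap — whose
`vdr_of_spectralGap` is the VDR algebra reusable for ANY `M` once a β-uniform gap + entropy bound is known —, p165546
PlanarSliceKernelGaugeFixing); imported above and used by name in the `M = 0` branch of `FibreAnchor_of`. -/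


/-- **Stub S1₊ — vacuum dominance with a rate, THICK fibres `M ≥ 1` (THE OPEN CORE; lead reshape r3 =
the former S1 restricted to `1 ≤ M`).** For every compact simple `G`, faithful unitary `r` and fibre width `M ≥ 1`
there are `β₀` and a β-UNIFORM rate `m₀ > 0` such that for every `β ≥ β₀` there are `C` and a floor `L_min` with:
for every `L ≥ L_min` there is `lam > 0` such that the Wilson partition functions `Z(L, j)` of the FREE TUBES WITH
TIME PERIOD `j+1` AND SPACE PERIOD `L`, `(ℤ/(j+1))×(ℤ/L)×Fin(M+1)²` (inline: product Haar, weight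
`exp(β Σ ins·Re tr r.ρ(U_P))`, free fibre faces), satisfy `lam^{j+1} ≤ Z(L, j)` for all `j ≥ 1`, and
`Z(L, j) ≤ lam^{j+1}·exp(C·L·e^{−m₀ (j+1)})` for `2 ≤ j+1 ≤ L`. Encodes: transfer-matrix gap `≥ m₀` uniformly in
`β ≥ β₀(M)` and `L ≥ L_min(β)` (KK threshold `≈ 2·arccosh(1+λ₁/2)`, `λ₁ = 2−2cos(π/(M+1))`; torelons `σ₂(β)L ≥ m₀`
by the floor) AND free-gas control of the low-lying density of states (`L` one-particle momenta). Intended proof: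
Kotecký–Preiss polymer expansion of `log Z(L, j)` at fixed `M` around [the exactly solvable 2-d zero mode] ⊗
[massive KK Gaussian in fibre tree gauge], activities bounded uniformly in the zero-mode background by the
diamagnetic bound; winding clusters give the `L·e^{−m₀ j}` corrections. NOT IN PRINT (XL).
[KoteckyPreiss1986; doi:10.1007/BF01238860 (Borgs–Imbrie); doi:10.1016/0003-4916(84)90121-0
(Bałaban–Brydges–Imbrie–Jaffe); doi:10.1016/0550-3213(79)90095-6 (Brydges–Fröhlich–Seiler); doi:10.1007/BF01211589
(Lüscher 1986)] -/
theorem stub_vdrThick :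
    ∀ (G : Type) [Group G] [TopologicalSpace G] [IsTopologicalGroup G] [CompactSpace G], Literature.MathematicalPhysics.QuantumFieldTheory.IsCompactSimpleLieGroup G → letI : MeasurableSpace G := borel G; haveI : BorelSpace G := ⟨rfl⟩; ∀ r : Literature.MathematicalPhysics.QuantumFieldTheory.LatticeRep G, let VDR := fun (M : ℕ) (β m₀ C : ℝ) (Lmin : ℕ) => ∀ (L : ℕ) [NeZero L], Lmin ≤ L → let Zt : ℕ → ℝ := fun j => let St := ZMod (j + 1) × ZMod L × Fin (M + 1) × Fin (M + 1); let Cfg := St × Fin 4 → G; let ν : MeasureTheory.Measure Cfg := MeasureTheory.Measure.pi fun _ => Literature.MathematicalPhysics.QuantumFieldTheory.haarProbability G; let sh : St → Fin 4 → St := fun x μ => ![(x.1 + 1, x.2.1, x.2.2.1, x.2.2.2), (x.1, x.2.1 + 1, x.2.2.1, x.2.2.2), (x.1, x.2.1, x.2.2.1 + 1, x.2.2.2), (x.1, x.2.1, x.2.2.1, x.2.2.2 + 1)] μ; let ins : St → Fin 4 → Fin 4 → ℝ := fun x μ κ => if ((μ = 2 ∨ κ = 2) → (x.2.2.1 : ℕ)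 < M) ∧ ((μ = 3 ∨ κ = 3) → (x.2.2.2 : ℕ) < M) then 1 else 0; let pl : Cfg → St → Fin 4 → Fin 4 → G := fun U x μ κ => U (x, μ) * U (sh x μ, κ) * (U (sh x κ, μ))⁻¹ * (U (x, κ))⁻¹; let act : Cfg → ℝ := fun U => β * ∑ x : St, ∑ q : {q : Fin 4 × Fin 4 // q.1 < q.2}, ins x q.1.1 q.1.2 * (r.ρ (pl U x q.1.1 q.1.2)).trace.re; ∫ U, Real.exp (act U) ∂ν; ∃ lam : ℝ, 0 < lam ∧ (∀ j : ℕ, 1 ≤ j → lam ^ (j + 1) ≤ Zt j) ∧ ∀ j : ℕ, 1 ≤ j → j + 1 ≤ L → Zt j ≤ lam ^ (j + 1) * Real.exp (C * (L : ℝ) * Real.exp (-(m₀ * (j + 1)))); ∀ M : ℕ, 1 ≤ M → ∃ β₀ m₀ : ℝ, 0 < m₀ ∧ ∀ β : ℝ, β₀ ≤ β → ∃ C : ℝ, ∃ Lmin : ℕ, VDR M β m₀ C Lmin := by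
  sorry

/-! Stub S2a `stub_traceFormulaClustering` (trace-formula clustering with an absolute constant) LANDED:
`Summits/QuantumFields/YangMills/Theorems/ContractibleFibreFibreAnchorTraceFormulaClustering.lean` (p162688, wave 1);
it is imported above and consumed by name inside the proof of S2b. -/


/-! Stub S2b `stub_tracePackaging` (time-slicing of the free tube; registered r2 form without the S2a antecedent)
LANDED: `Summits/QuantumFields/YangMills/Theorems/ContractibleFibreFibreAnchorTracePackaging.lean` (p162988, wave 1 +
lead re-cut); imported above and used by name in `FibreAnchor_of`. -/


/-- **Composition** — the stubs BY NAME give the crux BY NAME: fix `G, r, M`; for `M = 0` the planar stub S1₀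
(at VDR rate `1`) and the landed packaging S2b answer the crux with threshold `0` and rate `1/2`; for `M ≥ 1` the
thick stub S1₊ gives `β₀` and the β-uniform `m₀ > 0`, the crux is answered with threshold `max β₀ 0` and rate
`m₀ / 2`, feeding S1₊'s `C, L_min` and VDR family to S2b (which consumes the landed S2a) at slab width `w`. -/
theorem FibreAnchor_of : FibreAnchor := by
  intro G _ _ _ _ hG r Tube M
  rcases Nat.eq_zero_or_pos M with rfl | hM
  · refine ⟨0, 1 / 2, by norm_num, fun β hβ w => ?_⟩
    obtain ⟨C, Lmin, hV⟩ := stub_vdrPlanar G hG r 1 one_pos β hβ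
    exact stub_tracePackaging G hG r 0 β 1 C Lmin hβ one_pos hV w
  · obtain ⟨β₀, m₀, hm₀, h⟩ := stub_vdrThick G hG r M hM
    refine ⟨max β₀ 0, m₀ / 2, half_pos hm₀, fun β hβ w => ?_⟩
    obtain ⟨C, Lmin, hV⟩ := h β ((le_max_left _ _).trans hβ)
    exact stub_tracePackaging G hG r M β m₀ C Lmin ((le_max_right _ _).trans hβ) hm₀ hV w

/-- Signature match: the registered composition has literally the route's crux as its type. -/
example : Summit.QuantumFields.YangMills.Theses.ContractibleFibre.FibreAnchor := FibreAnchor_of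

end Summit.QuantumFields.YangMills.Cruxes.FibreAnchor.TraceVDR

end
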